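import Literature.Geometry.Lorentzian.CarterNearZone
import Literature.Geometry.Lorentzian.TeukolskyRadialSchrodingerForm
import Literature.Geometry.Lorentzian.TeukolskyHorizonNormalisedLimits
import HarnessLib

/-!
# The horizon pocket of Carter's equation for `|ξ| ≥ 1`: a flux-free a priori bound, polynomial in
# `(ω² + 6Λ/M²)/σ²`, for the `𝓗⁺`-normalised solution
(namespace `Literature.Geometry.Lorentzian.Kerr`.)

Companion of `CarterHorizonZone.lean`. There the coefficient `φ = ω² − V ∘ ρ` of Carter's equation
`u″ + φ u = 0` (`V = Kerr.sepPotential M a ω m Λ`, tortoise radius `ρ`; DRSR arXiv:1402.7034 §5.2.3)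
is pinched in `[σ²/2, 3σ²/2]` on the zone `ρ − r₊ ≤ σ²M³/(416Λ)` (`σ = ω − mω₊`), a zone whose
radial size shrinks like `σ²`. Here we record the LARGER pocket on which `φ` merely stays comparable
to `σ²` from below, `φ ≥ σ²/800`, whose size is LINEAR in `|σ|`:

  `ρ − r₊ ≤ c₁|σ|(r₊² + a²)`, `ρ − r₊ ≤ M`, provided `r₊ − r₋ ≤ |σ|(r₊² + a²)`

(i.e. `|ξ| ≥ 1` for `ξ = σ/2κ`, `κ = (r₊ − r₋)/(2(r₊² + a²))`; in the blown-up radius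
`x = (r − r₊)/(r₊ − r₋)` the pocket is `x ≤ c₁|ξ|`), with `c₁ ≤ 1`, `10M|ω|c₁ ≤ 1`,
`16(2Λ + 3)c₁ ≤ 1`. The mechanism (`coeff_lower_of_horizonPocket`): writing
`(r² + a²)²φ = K² − Δ(Λ − 2amω) − (r² + a²)²V₁` (`sq_mul_coeff_eq`, `K = Kerr.radialK`) and
`K = (r₊² + a²)σ + ω(r − r₊)(r + r₊)` (`radialK_eq_horizon_add`), on the pocket `|K| ≥ (r₊² + a²)|σ|/2`
while `Δ ≤ 2c₁σ²(r₊² + a²)²` and `0 ≤ (r² + a²)²V₁ ≤ 3Δ` (`sq_mul_sepPotential₁_le`).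
Consequences, by the piecewise Sonin argument of `CarterHorizonZone` (≤ 8 monotone pieces,
`Literature.Analysis.ODE.soninEnergy_le_pow_ratio`, ratio `800Φ/σ²`, `Φ = ω² + 6Λ/M²`):

* `horizonPocket_soninEnergy_le` — for the solution with `𝓗⁺` data (`‖u‖ → 1`, `‖u′‖ → |σ|`):
  `φ‖u‖² + ‖u′‖² ≤ 3σ²·(800Φ/σ²)^8` on the pocket, hence (`horizonPocket_normSq_le`)
  `‖u‖² ≤ 2400(800Φ/σ²)^8`, `‖u′‖² ≤ 3σ²(800Φ/σ²)^8`;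
* `horizonPocket_weightedNormSq_le` — the same in the `r`-variable for the TdC-normalised radial
  function `R_𝓗` (`u = √(r² + a²)R`, `u′ = (Δ/(r² + a²))d/dr[√(r² + a²)R]`), the tortoise function
  being introduced and eliminated inside the proof.

With `|σ| ≥ 2κ` the ratio `800Φ/σ²` is a POWER of `κ⁻¹` times a bounded-frequency constant: this is
the `|ξ| ≥ 1` half of the polynomial sup bound for `R_𝓗` near extremality (crux
`KappaExplicitWaveDecay`, stub `stub_horizonSupBoxPoly`); no flux sign and no transport factor
`exp(ηL)` enter.

## References
* M. Dafermos, I. Rodnianski, Y. Shlapentokh-Rothman, arXiv:1402.7034 = Ann. of Math. 183 (2016),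
  §5.2.3, Lemma 6.3.2, §8 (key `DafermosRodnianskiShlapentokhrothman2014`).
* G. Szegő, *Orthogonal Polynomials*, §7.31 (Sonin–Pólya).
-/

noncomputable section

open Filter Set
open scoped _root_.Topology

namespace Literature.Geometry.Lorentzian

namespace Kerr

/-! ### Algebra of the coefficient: `(r² + a²)²(ω² − V) = K² − Δ(Λ − 2amω) − (r² + a²)²V₁` -/

/-- `K(r) = (r₊² + a²)σ + ω(r − r₊)(r + r₊)` with `σ = ω − mω₊` (`|a| ≤ M`, `0 < M`): since
`r₊² + a² = 2Mr₊` and `ω₊ = a/(2Mr₊)`, `K(r₊) = ω(r₊² + a²) − am = (r₊² + a²)σ`. [folklore] -/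
theorem radialK_eq_horizon_add {M a : ℝ} (hM : 0 < M) (haM : |a| ≤ M) (ω : ℝ) (m : ℤ) (r : ℝ) :
    radialK a ω m r = (rPlus M a ^ 2 + a ^ 2) * (ω - m * horizonAngularVelocity M a) +
      ω * (r - rPlus M a) * (r + rPlus M a) := by
  have hr : 0 < rPlus M a := rPlus_pos hM a
  rw [horizonAngularVelocity, ← rPlus_sq_add_sq haM, radialK]
  have hA : rPlus M a ^ 2 + a ^ 2 ≠ 0 := by positivity
  field_simp
  ring

/-- `(r² + a²)²(ω² − V(r)) = K(r)² − Δ(r)(Λ − 2amω) − (r² + a²)²V₁(r)` wherever `r² + a² ≠ 0`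
(`V = V₀ + V₁`, `(r² + a²)²(ω² − V₀) = K² − Δ(Λ − 2amω)` because `r² + a² − Δ = 2Mr`).
[cite: DafermosRodnianskiShlapentokhrothman2014, §6.2] -/
theorem sq_mul_coeff_eq (M a ω : ℝ) (m : ℤ) (Λ : ℝ) {r : ℝ} (hA : r ^ 2 + a ^ 2 ≠ 0) :
    (r ^ 2 + a ^ 2) ^ 2 * (ω ^ 2 - sepPotential M a ω m Λ r) =
      radialK a ω m r ^ 2 - delta M a r * (Λ - 2 * a * m * ω) -
        (r ^ 2 + a ^ 2) ^ 2 * sepPotential₁ M a r := by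
  unfold sepPotential sepPotential₀ radialK delta
  field_simp
  ring

/-- `(r² + a²)²V₁(r) ≤ 3Δ(r)` for `|a| ≤ M`, `0 < M`, `r₊ ≤ r`
(`V₁ = Δ(a²Δ + 2Mr(r² − a²))/(r² + a²)⁴`, and `a²Δ + 2Mr(r² − a²) ≤ 3(r² + a²)²` from `Δ ≤ r² + a²`,
`M ≤ r`). [cite: DafermosRodnianskiShlapentokhrothman2014, §6.2] -/
theorem sq_mul_sepPotential₁_le {M a r : ℝ} (hM : 0 < M) (haM : |a| ≤ M) (hr : rPlus M a ≤ r) :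
    (r ^ 2 + a ^ 2) ^ 2 * sepPotential₁ M a r ≤ 3 * delta M a r := by
  have hMr : M ≤ r := (M_le_rPlus M a).trans hr
  have hr0 : 0 < r := hM.trans_le hMr
  have hA : 0 < r ^ 2 + a ^ 2 := by positivity
  have hΔ : 0 ≤ delta M a r := delta_nonneg haM hr
  rw [sepPotential₁_eq M a hA.ne']
  have hX : a ^ 2 * delta M a r + 2 * M * r * (r ^ 2 - a ^ 2) ≤ 3 * (r ^ 2 + a ^ 2) ^ 2 := by
    unfold delta
    nlinarith [mul_le_mul_of_nonneg_right hMr (by positivity : (0 : ℝ) ≤ 2 * r ^ 3),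
      mul_nonneg (mul_nonneg hM.le hr0.le) (sq_nonneg a), sq_nonneg (r ^ 2),
      mul_nonneg (sq_nonneg r) (sq_nonneg a), sq_nonneg (a ^ 2)]
  have e : (r ^ 2 + a ^ 2) ^ 2 * (delta M a r / (r ^ 2 + a ^ 2) ^ 4 *
      (a ^ 2 * delta M a r + 2 * M * r * (r ^ 2 - a ^ 2))) =
      delta M a r * (a ^ 2 * delta M a r + 2 * M * r * (r ^ 2 - a ^ 2)) / (r ^ 2 + a ^ 2) ^ 2 := by
    field_simp
  rw [e, div_le_iff₀ (by positivity)]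
  nlinarith [mul_le_mul_of_nonneg_left hX hΔ]

/-! ### The coefficient on the pocket is at least `σ²/800` -/
set_option maxHeartbeats 400000 in -- buildfix (bf3-g27): 160k/180k FAIL, 200k PASS at accept time; line-neutral budget line
/-- **Lower bound for Carter's coefficient on the `|ξ| ≥ 1` pocket.** Let `0 < M`, `|a| ≤ M`,
`(ω, m, Λ)` admissible, `σ = ω − mω₊`, and `0 < c₁ ≤ 1` with `10M|ω|c₁ ≤ 1`, `16(2Λ + 3)c₁ ≤ 1`.
If `r₊ − r₋ ≤ |σ|(r₊² + a²)` (i.e. `|ξ| ≥ 1`) then at every `r` with `r₊ ≤ r`,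
`r − r₊ ≤ c₁|σ|(r₊² + a²)` and `r − r₊ ≤ M`: `σ²/800 ≤ ω² − V(r)`. Proof:
`|K| ≥ (r₊² + a²)|σ| − |ω|(r − r₊)(r + r₊) ≥ (r₊² + a²)|σ|/2` (`r + r₊ ≤ 5M`),
`Δ = (r − r₊)(r − r₊ + (r₊ − r₋)) ≤ 2c₁σ²(r₊² + a²)²`, `|Λ − 2amω| ≤ 2Λ`, `(r² + a²)²V₁ ≤ 3Δ`, so
`(r² + a²)²(ω² − V) ≥ σ²(r₊² + a²)²/8`, and `r² + a² ≤ 10(r₊² + a²)`. [folklore] -/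
theorem coeff_lower_of_horizonPocket {M a ω Λ c₁ : ℝ} {m : ℤ} (hM : 0 < M) (haM : |a| ≤ M)
    (hadm : IsAdmissibleTriple a ω m Λ) (hc₀ : 0 < c₁) (hc₁ : c₁ ≤ 1)
    (hcω : 10 * M * |ω| * c₁ ≤ 1) (hcΛ : 16 * (2 * Λ + 3) * c₁ ≤ 1)
    (hσ : rPlus M a - rMinus M a ≤ |ω - m * horizonAngularVelocity M a| * (rPlus M a ^ 2 + a ^ 2))
    {r : ℝ} (hr : rPlus M a ≤ r)
    (hr₁ : r - rPlus M a ≤ c₁ * |ω - m * horizonAngularVelocity M a| * (rPlus M a ^ 2 + a ^ 2))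
    (hrM : r - rPlus M a ≤ M) :
    (ω - m * horizonAngularVelocity M a) ^ 2 / 800 ≤ ω ^ 2 - sepPotential M a ω m Λ r := by
  set σ := ω - m * horizonAngularVelocity M a with hσ_def
  set Ap := rPlus M a ^ 2 + a ^ 2 with hAp_def
  have hrp : 0 < rPlus M a := rPlus_pos hM a
  have hMrp : M ≤ rPlus M a := M_le_rPlus M a
  have hrp2 : rPlus M a ≤ 2 * M := rPlus_le_two_mul_self hM.le a
  have hr0 : 0 < r := hrp.trans_le hr
  have hA : 0 < r ^ 2 + a ^ 2 := by positivity
  have hAp : 0 < Ap := by positivity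
  have ha2 : a ^ 2 ≤ M ^ 2 := by nlinarith [abs_nonneg a, sq_abs a, abs_nonneg a]
  have hApM : M ^ 2 ≤ Ap := by nlinarith [sq_nonneg a]
  -- `r² + a² ≤ 10 Ap`
  have hA10 : r ^ 2 + a ^ 2 ≤ 10 * Ap := by nlinarith
  -- `|K| ≥ Ap|σ|/2`
  have hK : radialK a ω m r = Ap * σ + ω * (r - rPlus M a) * (r + rPlus M a) :=
    radialK_eq_horizon_add hM haM ω m r
  have hE : |ω * (r - rPlus M a) * (r + rPlus M a)| ≤ Ap * |σ| / 2 := by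
    rw [abs_mul, abs_mul, abs_of_nonneg (sub_nonneg.2 hr), abs_of_pos (by linarith : 0 < r + rPlus M a)]
    have h5 : r + rPlus M a ≤ 5 * M := by linarith
    calc |ω| * (r - rPlus M a) * (r + rPlus M a) ≤ |ω| * (c₁ * |σ| * Ap) * (5 * M) := by
          gcongr
      _ = (10 * M * |ω| * c₁) * (Ap * |σ| / 2) := by ring
      _ ≤ 1 * (Ap * |σ| / 2) := by gcongr
      _ = Ap * |σ| / 2 := one_mul _
  have hKabs : Ap * |σ| / 2 ≤ |radialK a ω m r| := by
    have h1 : |Ap * σ| ≤ |radialK a ω m r| + |ω * (r - rPlus M a) * (r + rPlus M a)| := by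
      calc |Ap * σ| = |radialK a ω m r + -(ω * (r - rPlus M a) * (r + rPlus M a))| := by
            rw [hK]; ring_nf
        _ ≤ |radialK a ω m r| + |-(ω * (r - rPlus M a) * (r + rPlus M a))| := abs_add_le _ _
        _ = _ := by rw [abs_neg]
    rw [abs_mul, abs_of_pos hAp] at h1
    linarith
  have hK2 : Ap ^ 2 * σ ^ 2 / 4 ≤ radialK a ω m r ^ 2 := by
    have h0 : 0 ≤ Ap * |σ| / 2 := by positivity
    have h := pow_le_pow_left₀ h0 hKabs 2
    rw [sq_abs] at h
    calc Ap ^ 2 * σ ^ 2 / 4 = (Ap * |σ| / 2) ^ 2 := by rw [div_pow, mul_pow, sq_abs]; ring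
      _ ≤ radialK a ω m r ^ 2 := h
  -- `Δ ≤ 2c₁σ²Ap²`
  have hΔ0 : 0 ≤ delta M a r := delta_nonneg haM hr
  have hΔ : delta M a r ≤ 2 * c₁ * σ ^ 2 * Ap ^ 2 := by
    rw [delta_eq_mul haM]
    have h1 : r - rMinus M a ≤ (c₁ + 1) * |σ| * Ap := by
      have : r - rMinus M a = (r - rPlus M a) + (rPlus M a - rMinus M a) := by ring
      rw [this]; nlinarith
    have h2 : 0 ≤ r - rMinus M a := by linarith [rMinus_le_rPlus M a]
    calc (r - rPlus M a) * (r - rMinus M a) ≤ (c₁ * |σ| * Ap) * ((c₁ + 1) * |σ| * Ap) :=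
          mul_le_mul hr₁ h1 h2 (by positivity)
      _ = c₁ * (c₁ + 1) * σ ^ 2 * Ap ^ 2 := by rw [← sq_abs σ]; ring
      _ ≤ 2 * c₁ * σ ^ 2 * Ap ^ 2 := by
          have : c₁ * (c₁ + 1) ≤ 2 * c₁ := by nlinarith
          have h3 : 0 ≤ σ ^ 2 * Ap ^ 2 := by positivity
          nlinarith
  -- `|Λ − 2amω| ≤ 2Λ`
  have hΛ' : |Λ - 2 * a * m * ω| ≤ 2 * Λ := by
    have h2 := hadm.2
    have hΛ0 := hadm.nonneg
    have : |2 * a * m * ω| = 2 * |a * m * ω| := by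
      rw [show 2 * a * (m : ℝ) * ω = 2 * (a * m * ω) by ring, abs_mul, abs_two]
    calc |Λ - 2 * a * m * ω| ≤ |Λ| + |2 * a * m * ω| := abs_sub _ _
      _ ≤ Λ + Λ := by rw [abs_of_nonneg hΛ0, this]; linarith
      _ = 2 * Λ := by ring
  -- the `V₁` term
  have hV₁ := sq_mul_sepPotential₁_le hM haM hr
  -- assemble `(r² + a²)² φ ≥ Ap²σ²/8`
  have hid := sq_mul_coeff_eq M a ω m Λ hA.ne'
  have hmain : Ap ^ 2 * σ ^ 2 / 8 ≤ (r ^ 2 + a ^ 2) ^ 2 * (ω ^ 2 - sepPotential M a ω m Λ r) := by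
    rw [hid]
    have h1 : delta M a r * (Λ - 2 * a * m * ω) ≤ delta M a r * (2 * Λ) :=
      mul_le_mul_of_nonneg_left ((le_abs_self _).trans hΛ') hΔ0
    have hΛ0 := hadm.nonneg
    have h2 : delta M a r * (2 * Λ + 3) ≤ 2 * c₁ * σ ^ 2 * Ap ^ 2 * (2 * Λ + 3) :=
      mul_le_mul_of_nonneg_right hΔ (by linarith)
    have h3 : 2 * c₁ * (2 * Λ + 3) ≤ 1 / 8 := by linarith
    have h4 : 0 ≤ σ ^ 2 * Ap ^ 2 := by positivity
    have h5 : 2 * c₁ * (2 * Λ + 3) * (σ ^ 2 * Ap ^ 2) ≤ 1 / 8 * (σ ^ 2 * Ap ^ 2) :=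
      mul_le_mul_of_nonneg_right h3 h4
    have hV0 : 0 ≤ (r ^ 2 + a ^ 2) ^ 2 * sepPotential₁ M a r :=
      mul_nonneg (sq_nonneg _) (sepPotential₁_nonneg haM hr)
    linarith [hK2, h1, hV₁, h2, h5]
  -- divide by `(r² + a²)² ≤ 100 Ap²`
  have hA2 : (r ^ 2 + a ^ 2) ^ 2 ≤ 100 * Ap ^ 2 := by
    calc (r ^ 2 + a ^ 2) ^ 2 ≤ (10 * Ap) ^ 2 := pow_le_pow_left₀ hA.le hA10 2
      _ = 100 * Ap ^ 2 := by ring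
  by_contra hcon
  push Not at hcon
  have hσ2 : 0 ≤ σ ^ 2 := sq_nonneg σ
  have h5 : (r ^ 2 + a ^ 2) ^ 2 * (ω ^ 2 - sepPotential M a ω m Λ r) <
      (r ^ 2 + a ^ 2) ^ 2 * (σ ^ 2 / 800) := mul_lt_mul_of_pos_left hcon (by positivity)
  have h6 : (r ^ 2 + a ^ 2) ^ 2 * (σ ^ 2 / 800) ≤ 100 * Ap ^ 2 * (σ ^ 2 / 800) :=
    mul_le_mul_of_nonneg_right hA2 (by positivity)
  linarith

/-! ### Sonin bounds on the pocket for the solution with `𝓗⁺` data -/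

section Pocket

variable {M a ω Λ c₁ : ℝ} {m : ℤ} {ρ : ℝ → ℝ} {u u₁ : ℝ → ℂ}

/-- **Sonin energy on the `|ξ| ≥ 1` pocket, `𝓗⁺` data.** Let `u″ + (ω² − V(ρ x))u = 0` along a
tortoise radius (`|a| < M`, admissible triple with `Λ ≥ 1`), with `‖u‖ → 1`, `‖u′‖ → |σ|` at `−∞`
(`σ = ω − mω₊`), and let `c₁`, `σ` be as in `coeff_lower_of_horizonPocket`. Then at every `y` with
`ρ y − r₊ ≤ c₁|σ|(r₊² + a²)` and `ρ y − r₊ ≤ M`: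
`(ω² − V(ρ y))‖u y‖² + ‖u′ y‖² ≤ (Φ/(σ²/800))^8 · 3σ²`, `Φ = ω² + 6Λ/M²`
(the energy tends to `2σ²` at `−∞`; at most eight monotone pieces of the coefficient, which stays in
`[σ²/800, Φ]` on the pocket). [folklore] -/
theorem horizonPocket_soninEnergy_le (hρ : IsTortoiseRadius M a ρ) (hMa : IsSubextremal M a)
    (hadm : IsAdmissibleTriple a ω m Λ) (hΛ : 1 ≤ Λ) (hc₀ : 0 < c₁) (hc₁ : c₁ ≤ 1)
    (hcω : 10 * M * |ω| * c₁ ≤ 1) (hcΛ : 16 * (2 * Λ + 3) * c₁ ≤ 1)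
    (hσ : rPlus M a - rMinus M a ≤ |ω - m * horizonAngularVelocity M a| * (rPlus M a ^ 2 + a ^ 2))
    (hu : ∀ x, HasDerivAt u (u₁ x) x ∧
      HasDerivAt u₁ (-(((ω ^ 2 - sepPotential M a ω m Λ (ρ x) : ℝ) : ℂ) * u x)) x)
    (hlim : Tendsto (fun x ↦ ‖u x‖) atBot (𝓝 1))
    (hlim₁ : Tendsto (fun x ↦ ‖u₁ x‖) atBot (𝓝 |ω - m * horizonAngularVelocity M a|)) {y : ℝ}
    (hy₁ : ρ y - rPlus M a ≤ c₁ * |ω - m * horizonAngularVelocity M a| * (rPlus M a ^ 2 + a ^ 2))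
    (hyM : ρ y - rPlus M a ≤ M) :
    (ω ^ 2 - sepPotential M a ω m Λ (ρ y)) * ‖u y‖ ^ 2 + ‖u₁ y‖ ^ 2 ≤
      ((ω ^ 2 + 6 * Λ / M ^ 2) / ((ω - m * horizonAngularVelocity M a) ^ 2 / 800)) ^ 8 *
        (3 * (ω - m * horizonAngularVelocity M a) ^ 2) := by
  have hM : 0 < M := hMa.pos
  have haM : |a| ≤ M := le_of_lt hMa
  set σ := ω - m * horizonAngularVelocity M a with hσ_def
  set Φ := ω ^ 2 + 6 * Λ / M ^ 2 with hΦ_def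
  set φ : ℝ → ℝ := fun s ↦ ω ^ 2 - sepPotential M a ω m Λ (ρ s) with hφ_def
  -- `σ ≠ 0` (from `0 < r₊ − r₋ ≤ |σ|(r₊² + a²)`)
  have hd : 0 < rPlus M a - rMinus M a := sub_pos.2 hMa.rMinus_lt_rPlus
  have hσ0 : 0 < |σ| := by
    by_contra h
    push Not at h
    have : |σ| = 0 := le_antisymm h (abs_nonneg σ)
    rw [this, zero_mul] at hσ
    linarith
  have hσ2 : 0 < σ ^ 2 := by rw [← sq_abs]; positivity
  have hmin : 0 < σ ^ 2 / 800 := by positivity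
  -- the coefficient on `(−∞, y]` lies in `[σ²/800, Φ]`
  have hzone : ∀ s, s ≤ y → σ ^ 2 / 800 ≤ φ s ∧ φ s ≤ Φ := by
    intro s hs
    have hmono : ρ s ≤ ρ y := (hρ.strictMono hMa).monotone hs
    refine ⟨coeff_lower_of_horizonPocket hM haM hadm hc₀ hc₁ hcω hcΛ hσ (hρ.rPlus_lt s).le
      (by linarith) (by linarith), ?_⟩
    exact coeff_le_of_admissible hM haM hadm hΛ (hρ.rPlus_lt s).le
  -- the energy tends to `2σ²` at `−∞`, hence is eventually `≤ 3σ²`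
  have hT : Tendsto (fun x ↦ φ x * ‖u x‖ ^ 2 + ‖u₁ x‖ ^ 2) atBot (𝓝 (2 * σ ^ 2)) := by
    have h := ((hρ.tendsto_coeff_atBot hMa ω m Λ).mul (hlim.pow 2)).add (hlim₁.pow 2)
    have e : σ ^ 2 * 1 ^ 2 + |σ| ^ 2 = 2 * σ ^ 2 := by rw [one_pow, mul_one, sq_abs]; ring
    rw [e] at h
    exact h
  have hev : ∀ᶠ x in atBot, φ x * ‖u x‖ ^ 2 + ‖u₁ x‖ ^ 2 ≤ 3 * σ ^ 2 :=
    hT.eventually (eventually_le_nhds (by nlinarith : 2 * σ ^ 2 < 3 * σ ^ 2))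
  obtain ⟨x, hxT, hxy⟩ := (hev.and (eventually_le_atBot y)).exists
  -- the ratio `Φ/(σ²/800) ≥ 1`
  have hratio : 1 ≤ Φ / (σ ^ 2 / 800) := by
    rw [le_div_iff₀ hmin, one_mul]
    exact (hzone y le_rfl).1.trans (hzone y le_rfl).2
  rcases eq_or_lt_of_le hxy with hxy' | hxy'
  · -- `x = y`
    subst hxy'
    have h38 : (1 : ℝ) ≤ (Φ / (σ ^ 2 / 800)) ^ 8 := one_le_pow₀ hratio
    have hT0 : 0 ≤ φ x * ‖u x‖ ^ 2 + ‖u₁ x‖ ^ 2 :=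
      add_nonneg (mul_nonneg (hmin.le.trans (hzone x le_rfl).1) (sq_nonneg _)) (sq_nonneg _)
    calc φ x * ‖u x‖ ^ 2 + ‖u₁ x‖ ^ 2 ≤ 3 * σ ^ 2 := hxT
      _ = 1 * (3 * σ ^ 2) := (one_mul _).symm
      _ ≤ (Φ / (σ ^ 2 / 800)) ^ 8 * (3 * σ ^ 2) := by gcongr
  obtain ⟨k, t, hk, ht0, htk, hmono_t, hmono⟩ := hρ.exists_monotone_partition hMa hadm hxy'
  have hbd : ∀ s ∈ Icc (t 0) (t k), σ ^ 2 / 800 ≤ φ s ∧ φ s ≤ Φ := by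
    intro s hs
    rw [htk] at hs
    exact hzone s hs.2
  have hxI : x ∈ Icc (t 0) (t k) := by rw [ht0, htk]; exact left_mem_Icc.2 hxy
  have hyI : y ∈ Icc (t 0) (t k) := by rw [ht0, htk]; exact right_mem_Icc.2 hxy
  have key := Literature.Analysis.ODE.soninEnergy_le_pow_ratio (u := u) (u' := u₁) (φ := φ)
    (φ' := fun s ↦ -(deriv (sepPotential M a ω m Λ) (ρ s) * (delta M a (ρ s) / (ρ s ^ 2 + a ^ 2))))
    (φmin := σ ^ 2 / 800) (φmax := Φ) t hmono_t
    (fun s _ ↦ ⟨(hu s).1, by simpa only [hφ_def] using (hu s).2⟩)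
    (fun s _ ↦ hρ.hasDerivAt_omega_sq_sub_sepPotential hMa ω m Λ s) hmono hmin hbd hxI hyI
  have hr0 : 0 ≤ Φ / (σ ^ 2 / 800) := zero_le_one.trans hratio
  have hTx : 0 ≤ φ x * ‖u x‖ ^ 2 + ‖u₁ x‖ ^ 2 :=
    add_nonneg (mul_nonneg (hmin.le.trans (hzone x hxy).1) (sq_nonneg _)) (sq_nonneg _)
  calc φ y * ‖u y‖ ^ 2 + ‖u₁ y‖ ^ 2 ≤ (Φ / (σ ^ 2 / 800)) ^ k * (φ x * ‖u x‖ ^ 2 + ‖u₁ x‖ ^ 2) := key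
    _ ≤ (Φ / (σ ^ 2 / 800)) ^ 8 * (φ x * ‖u x‖ ^ 2 + ‖u₁ x‖ ^ 2) :=
        mul_le_mul_of_nonneg_right (pow_le_pow_right₀ hratio hk) hTx
    _ ≤ (Φ / (σ ^ 2 / 800)) ^ 8 * (3 * σ ^ 2) := by gcongr

/-- Consequences on the `|ξ| ≥ 1` pocket (`𝓗⁺` data): `‖u y‖² ≤ 2400·(Φ/(σ²/800))^8` and
`‖u′ y‖² ≤ 3σ²·(Φ/(σ²/800))^8`, `Φ = ω² + 6Λ/M²` (divide the energy bound by `φ ≥ σ²/800`).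
[folklore] -/
theorem horizonPocket_normSq_le (hρ : IsTortoiseRadius M a ρ) (hMa : IsSubextremal M a)
    (hadm : IsAdmissibleTriple a ω m Λ) (hΛ : 1 ≤ Λ) (hc₀ : 0 < c₁) (hc₁ : c₁ ≤ 1)
    (hcω : 10 * M * |ω| * c₁ ≤ 1) (hcΛ : 16 * (2 * Λ + 3) * c₁ ≤ 1)
    (hσ : rPlus M a - rMinus M a ≤ |ω - m * horizonAngularVelocity M a| * (rPlus M a ^ 2 + a ^ 2))
    (hu : ∀ x, HasDerivAt u (u₁ x) x ∧
      HasDerivAt u₁ (-(((ω ^ 2 - sepPotential M a ω m Λ (ρ x) : ℝ) : ℂ) * u x)) x)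
    (hlim : Tendsto (fun x ↦ ‖u x‖) atBot (𝓝 1))
    (hlim₁ : Tendsto (fun x ↦ ‖u₁ x‖) atBot (𝓝 |ω - m * horizonAngularVelocity M a|)) {y : ℝ}
    (hy₁ : ρ y - rPlus M a ≤ c₁ * |ω - m * horizonAngularVelocity M a| * (rPlus M a ^ 2 + a ^ 2))
    (hyM : ρ y - rPlus M a ≤ M) :
    ‖u y‖ ^ 2 ≤ 2400 *
        ((ω ^ 2 + 6 * Λ / M ^ 2) / ((ω - m * horizonAngularVelocity M a) ^ 2 / 800)) ^ 8 ∧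
      ‖u₁ y‖ ^ 2 ≤ 3 * (ω - m * horizonAngularVelocity M a) ^ 2 *
        ((ω ^ 2 + 6 * Λ / M ^ 2) / ((ω - m * horizonAngularVelocity M a) ^ 2 / 800)) ^ 8 := by
  have hM : 0 < M := hMa.pos
  have haM : |a| ≤ M := le_of_lt hMa
  set σ := ω - m * horizonAngularVelocity M a with hσ_def
  set P := ((ω ^ 2 + 6 * Λ / M ^ 2) / (σ ^ 2 / 800)) ^ 8 with hP_def
  have hE := horizonPocket_soninEnergy_le hρ hMa hadm hΛ hc₀ hc₁ hcω hcΛ hσ hu hlim hlim₁ hy₁ hyM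
  have hφ : σ ^ 2 / 800 ≤ ω ^ 2 - sepPotential M a ω m Λ (ρ y) :=
    coeff_lower_of_horizonPocket hM haM hadm hc₀ hc₁ hcω hcΛ hσ (hρ.rPlus_lt y).le hy₁ hyM
  have hd : 0 < rPlus M a - rMinus M a := sub_pos.2 hMa.rMinus_lt_rPlus
  have hσ0 : 0 < |σ| := by
    by_contra h
    push Not at h
    have : |σ| = 0 := le_antisymm h (abs_nonneg σ)
    rw [this, zero_mul] at hσ
    linarith
  have hσ2 : 0 < σ ^ 2 := by rw [← sq_abs]; positivity
  have hP0 : 0 ≤ P := by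
    have h1 : 0 ≤ (ω ^ 2 + 6 * Λ / M ^ 2) / (σ ^ 2 / 800) :=
      div_nonneg (le_trans (by positivity) (hφ.trans
        (coeff_le_of_admissible hM haM hadm hΛ (hρ.rPlus_lt y).le))) (by positivity)
    positivity
  have hu2 : 0 ≤ ‖u₁ y‖ ^ 2 := sq_nonneg _
  have hf : 0 ≤ ‖u y‖ ^ 2 := sq_nonneg _
  refine ⟨?_, ?_⟩
  · have h1 : σ ^ 2 / 800 * ‖u y‖ ^ 2 ≤ P * (3 * σ ^ 2) := by
      nlinarith [mul_le_mul_of_nonneg_right hφ hf]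
    by_contra hcon
    push Not at hcon
    nlinarith
  · nlinarith [mul_nonneg (le_trans (by positivity) hφ) hf]

end Pocket

/-! ### The same bound for the TdC-normalised radial function `R_𝓗`, in the `r`-variable -/

/-- **A priori bound for `R_𝓗` on the `|ξ| ≥ 1` pocket.** Let `0 < M`, `|a| < M`, `(ω, m, Λ)`
admissible with `Λ ≥ 1`, `σ = ω − mω₊`, `0 < c₁ ≤ 1` with `10M|ω|c₁ ≤ 1`, `16(2Λ + 3)c₁ ≤ 1`, and
`r₊ − r₋ ≤ |σ|(r₊² + a²)`. For every classical solution `R` of the scalar radial Teukolsky ODE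
(`λ = Λ − a²ω²`) normalised at `𝓗⁺` as in Teixeira da Costa's Def. 2.3 and every `r > r₊` with
`r − r₊ ≤ c₁|σ|(r₊² + a²)`, `r − r₊ ≤ M`:
`(√(r² + a²)‖R r‖)² ≤ 2400(Φ/(σ²/800))^8` and
`((Δ/(r² + a²))‖(√(·² + a²)R)′(r)‖)² ≤ 3σ²(Φ/(σ²/800))^8`, `Φ = ω² + 6Λ/M²`
(`horizonPocket_normSq_le` along a tortoise radius, `Kerr.schrodingerForm`, and the horizon data
`Costa2019.tendsto_norm_(deriv_)horizonSolution`). [folklore] -/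
theorem horizonPocket_weightedNormSq_le {M a ω Λ c₁ : ℝ} {m : ℤ} (hM : 0 < M) (ha : |a| < M)
    (hadm : IsAdmissibleTriple a ω m Λ) (hΛ : 1 ≤ Λ) (hc₀ : 0 < c₁) (hc₁ : c₁ ≤ 1)
    (hcω : 10 * M * |ω| * c₁ ≤ 1) (hcΛ : 16 * (2 * Λ + 3) * c₁ ≤ 1)
    (hσ : rPlus M a - rMinus M a ≤ |ω - m * horizonAngularVelocity M a| * (rPlus M a ^ 2 + a ^ 2))
    {R : ℝ → ℂ} (hR : IsRadialTeukolskySolution M a 0 ω m (Λ - a ^ 2 * ω ^ 2) R)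
    (hn : IsNormalisedHorizonSolution M a 0 ω m R) {r : ℝ} (hr : rPlus M a < r)
    (hr₁ : r - rPlus M a ≤ c₁ * |ω - m * horizonAngularVelocity M a| * (rPlus M a ^ 2 + a ^ 2))
    (hrM : r - rPlus M a ≤ M) :
    (Real.sqrt (r ^ 2 + a ^ 2) * ‖R r‖) ^ 2 ≤ 2400 *
        ((ω ^ 2 + 6 * Λ / M ^ 2) / ((ω - m * horizonAngularVelocity M a) ^ 2 / 800)) ^ 8 ∧
      (delta M a r / (r ^ 2 + a ^ 2) *
          ‖deriv (fun s : ℝ ↦ ((Real.sqrt (s ^ 2 + a ^ 2) : ℝ) : ℂ) * R s) r‖) ^ 2 ≤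
        3 * (ω - m * horizonAngularVelocity M a) ^ 2 *
          ((ω ^ 2 + 6 * Λ / M ^ 2) / ((ω - m * horizonAngularVelocity M a) ^ 2 / 800)) ^ 8 := by
  have hsub : IsSubextremal M a := ha
  obtain ⟨ρ, hρ⟩ := exists_isTortoiseRadius hsub
  obtain ⟨y, hy⟩ := hρ.exists_apply_eq hr
  obtain ⟨u₁, u₂, hu⟩ := schrodingerForm hM ha hR hρ
  set u : ℝ → ℂ := fun x ↦ ((Real.sqrt (ρ x ^ 2 + a ^ 2) : ℝ) : ℂ) * R (ρ x) with hu_def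
  have hu' : ∀ x, HasDerivAt u (u₁ x) x ∧
      HasDerivAt u₁ (-(((ω ^ 2 - sepPotential M a ω m Λ (ρ x) : ℝ) : ℂ) * u x)) x := by
    intro x
    obtain ⟨h1, h2, h3, -⟩ := hu x
    refine ⟨h1, ?_⟩
    rwa [eq_neg_of_add_eq_zero_left h3] at h2
  have hu₁ : ∀ x, u₁ x = ((delta M a (ρ x) / (ρ x ^ 2 + a ^ 2) : ℝ) : ℂ) *
      deriv (fun s : ℝ ↦ ((Real.sqrt (s ^ 2 + a ^ 2) : ℝ) : ℂ) * R s) (ρ x) := fun x ↦ (hu x).2.2.2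
  have hnorm : ∀ x, ‖u x‖ = Real.sqrt (ρ x ^ 2 + a ^ 2) * ‖R (ρ x)‖ := fun x ↦ by
    simp only [hu_def, norm_mul, Complex.norm_of_nonneg (Real.sqrt_nonneg _)]
  have hnorm₁ : ∀ x, ‖u₁ x‖ = delta M a (ρ x) / (ρ x ^ 2 + a ^ 2) *
      ‖deriv (fun s : ℝ ↦ ((Real.sqrt (s ^ 2 + a ^ 2) : ℝ) : ℂ) * R s) (ρ x)‖ := fun x ↦ by
    rw [hu₁ x, norm_mul, Complex.norm_of_nonneg (hρ.deriv_pos hsub x).le]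
  -- horizon data along `ρ → r₊⁺`
  have hbot : Tendsto ρ atBot (𝓝[>] rPlus M a) := hρ.tendsto_nhdsGT
  have hlim : Tendsto (fun x ↦ ‖u x‖) atBot (𝓝 1) := by
    have h := (Costa2019.tendsto_norm_horizonSolution hn).comp hbot
    exact h.congr fun x ↦ (hnorm x).symm
  have hlim₁ : Tendsto (fun x ↦ ‖u₁ x‖) atBot (𝓝 |ω - m * horizonAngularVelocity M a|) := by
    have h := (Costa2019.tendsto_norm_deriv_horizonSolution hM ha hn).comp hbot
    exact h.congr fun x ↦ (hnorm₁ x).symm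
  have key := horizonPocket_normSq_le hρ hsub hadm hΛ hc₀ hc₁ hcω hcΛ hσ hu' hlim hlim₁ (y := y)
    (by rw [hy]; exact hr₁) (by rw [hy]; exact hrM)
  rw [hnorm y, hnorm₁ y, hy] at key
  exact key

end Kerr

end Literature.Geometry.Lorentzian

end
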